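import Literature.AlgebraicGeometry.Frobenioids.UnitTrivializationFunctoriality
import Literature.AlgebraicGeometry.Frobenioids.UnitTrivialisationFunctoriality
import Literature.AlgebraicGeometry.Frobenioids.EquivalenceUnitsDivSlim
import Literature.AlgebraicGeometry.Frobenioids.IsometricPreSteps
import Mathlib.CategoryTheory.ObjectProperty.Equivalence
import HarnessLib

/-!
# Frobenioids I, Theorem 3.4 (iv): the hypothesis `PreservesUnitEquiv` — instance forms (PROOF-ONLY)

Mochizuki, *The geometry of Frobenioids I: the general theory*, Kyushu J. Math. **62** (2008),
Definition 3.1 (iv) p. 57 (unit-equivalence `≈^{O^×}`), Theorem 3.4 (iv) p. 63 ll. 2–6, verbatim: «Then Ψ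
preserves the submonoids "O^⊿(−)", "O^×(−)"; Ψ_{ℕ≥1} is the identity automorphism. Moreover, there exists a
1-unique functor Ψ^un-tr : C₁^un-tr → C₂^un-tr that fits into a 1-commutative diagram» (the diagram and its
bracketed legend follow in print), proof p. 68, and Corollary 4.11 (i) p. 92 ll. 41–42, verbatim: «it suffices
to show that Ψ preserves "O^×(−)"» [cite: MochizukiFrdI2008, Thm. 3.4 (iv) p.63].  [Doc-only v2, referee
finding J16-F3: print asserts EXISTENCE of `Ψ^un-tr`; the v1 header's paraphrase "hence induces" inside the
quotation marks and its unmarked omission of "O^⊿(−)" are withdrawn; all declarations byte-identical.]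

PROOF-ONLY companion of `UnitTrivializationFunctoriality.lean` (seat abc-iut-L1-d1; FACT-LIST row F-1295,
`PreFrobenioidData.PreservesUnitEquiv`, a PARAMETRISED hypothesis predicate — R5: its universal closure is no
fact; what is provable are the instance forms at which the consumers bind it). The only consumer in the tree
is `FrdI.Thm34Sub.L10_UntrSquare` (both functors of an equivalence `C₁^istr ≌ C₂^istr`), discharged by
`PreFrobenioidData.exists_oneUniqueSquare_untr`; the instances at which that hypothesis is actually supplied
(`DivisorMonoidCategoryTheoreticityCorProofsVI.lean`) are restrictions `Ψ^istr` of equivalences of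
Frobenioids preserving `O^×(-)`. Recorded here, by name:

* `preservesUnitEquiv_id`, `PreservesUnitEquiv.comp` — identity and composition;
* `preservesUnitEquiv_of_isOfUnitTrivialType` — out of a pre-Frobenioid of unit-trivial type every functor
  preserves `≈^{O^×}` (there it is equality, Def. 3.1 (iv));
* `preservesUnitEquiv_of_units` — THE printed instance form: a functor `C₁^istr ⥤ C₂^istr` carrying every
  unit `δ ∈ O^×(X)` to a unit of its image preserves `≈^{O^×}` (= `unitEquiv_map_of_units`, by name);
* `preservesUnitEquiv_istr_of_mapIso_mem` — for an equivalence `Ψ : C₁ ≌ C₂` of pre-Frobenioids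
  `C_i → F_{Φ_i}` respecting isotropic objects, with `Ψ` carrying `O^×(A)` into `O^×(Ψ A)` (the conclusion of
  Thm. 3.4 (iv), row `L08`), the restriction `Ψ^istr` preserves `≈^{O^×}`;
* `preservesUnitEquiv_istr_of_isDivSlim` — hence unconditionally in the Div-slim situation of Cor. 4.11 (i)
  (units preserved by `mapIso_mem_unitsSubgroup_of_isDivSlim`, seat lineage abc-iut-found).

No new definitions; nothing of the paper is strengthened; nothing here bears on [IUTchIII] Cor. 3.12.
-/

namespace Literature.AlgebraicGeometry.Frobenioids

namespace PreFrobenioidData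

open CategoryTheory Opposite

universe w₁ v₁ v₁' u₁ u₁' w₂ v₂ v₂' u₂ u₂' w₃ v₃ v₃' u₃ u₃'

section General

variable {C₁ : Type u₁} [Category.{v₁} C₁] {D₁ : Type u₁'} [Category.{v₁'} D₁]
variable {C₂ : Type u₂} [Category.{v₂} C₂] {D₂ : Type u₂'} [Category.{v₂'} D₂]
variable {C₃ : Type u₃} [Category.{v₃} C₃] {D₃ : Type u₃'} [Category.{v₃'} D₃]
variable (S₁ : PreFrobenioidData.{w₁} C₁ D₁) (S₂ : PreFrobenioidData.{w₂} C₂ D₂)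
  (S₃ : PreFrobenioidData.{w₃} C₃ D₃)

/-- The identity functor of `C^istr` preserves unit-equivalence. [cite: MochizukiFrdI2008, Def. 3.1 (iv) p.57] -/
theorem preservesUnitEquiv_id : PreservesUnitEquiv S₁ S₁ (𝟭 S₁.Istr) := fun _ _ _ _ h => h

variable {S₁ S₂ S₃} in
/-- Functors preserving unit-equivalence compose. [cite: MochizukiFrdI2008, Def. 3.1 (iv) p.57] -/
theorem PreservesUnitEquiv.comp {Ψ : S₁.Istr ⥤ S₂.Istr} {Ψ' : S₂.Istr ⥤ S₃.Istr}
    (h : PreservesUnitEquiv S₁ S₂ Ψ) (h' : PreservesUnitEquiv S₂ S₃ Ψ') :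
    PreservesUnitEquiv S₁ S₃ (Ψ ⋙ Ψ') := fun _ _ α₁ α₂ hα => h' _ _ (h α₁ α₂ hα)

/-- Out of a pre-Frobenioid of unit-trivial type every functor `C₁^istr ⥤ C₂^istr` preserves
unit-equivalence ("if `C` is of unit-trivial type, then two co-objective morphisms of `C^istr` are
unit-equivalent if and only if they are equal", Def. 3.1 (iv)). [cite: MochizukiFrdI2008, Def. 3.1 (iv) p.57] -/
theorem preservesUnitEquiv_of_isOfUnitTrivialType (h : S₁.IsOfUnitTrivialType) (Ψ : S₁.Istr ⥤ S₂.Istr) :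
    PreservesUnitEquiv S₁ S₂ Ψ := fun _ _ α₁ α₂ hα => by
  rw [(unitEquiv_iff_eq_of_isUnitTrivialType S₁ h α₁ α₂).1 hα]
  exact UnitEquiv.refl S₂ _

/-- **The instance form of Thm. 3.4 (iv)**: a functor `Ψ : C₁^istr ⥤ C₂^istr` carrying every unit
`δ ∈ O^×(X)` (as an endomorphism of `X` in `C₁^istr`) to a unit of `Ψ X` — "`Ψ` preserves `O^×(-)`" —
preserves unit-equivalence (seat abc-iut-L1-t3's `unitEquiv_map_of_units`, by name).
[cite: MochizukiFrdI2008, Thm. 3.4 (iv) p.68] -/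
theorem preservesUnitEquiv_of_units (Ψ : S₁.Istr ⥤ S₂.Istr)
    (hunits : ∀ (X : S₁.Istr) (δ : Aut X.obj), δ ∈ S₁.unitsSubgroup X.obj →
      ∃ δ' : Aut (Ψ.obj X).obj, δ' ∈ S₂.unitsSubgroup (Ψ.obj X).obj ∧
        Ψ.map (ObjectProperty.homMk δ.hom) = ObjectProperty.homMk δ'.hom) :
    PreservesUnitEquiv S₁ S₂ Ψ :=
  unitEquiv_map_of_units S₁ S₂ Ψ hunits

end General

/-! ### The restriction `Ψ^istr` of an equivalence of pre-Frobenioids `C_i → F_{Φ_i}` -/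

section Functor

universe w v v' u u'

variable {D₁ : Type u} [Category.{v} D₁] {Φ₁ : D₁ᵒᵖ ⥤ CommMonCat.{w}}
  {C₁ : Type u'} [Category.{v'} C₁] (F₁ : C₁ ⥤ ElemFrobenioid Φ₁)
  {D₂ : Type u} [Category.{v} D₂] {Φ₂ : D₂ᵒᵖ ⥤ CommMonCat.{w}}
  {C₂ : Type u'} [Category.{v'} C₂] (F₂ : C₂ ⥤ ElemFrobenioid Φ₂)
  (Ψ : C₁ ≌ C₂)

/-- **`Ψ^istr` preserves `≈^{O^×}` when `Ψ` preserves `O^×(-)`.** For an equivalence `Ψ : C₁ ≌ C₂` whose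
isotropic objects correspond (`hinv`, Thm. 3.4 (i)) and which carries `O^×(A)` into `O^×(Ψ A)` (the
conclusion of Thm. 3.4 (iv)), the restricted equivalence `Ψ^istr : C₁^istr ≌ C₂^istr`
(`Equivalence.congrFullSubcategory`) has a functor preserving unit-equivalence — the hypothesis of
`FrdI.Thm34Sub.L10_UntrSquare` at the instance at which it is consumed. [cite: MochizukiFrdI2008, Thm. 3.4 (iv) p.68] -/
theorem preservesUnitEquiv_istr_of_mapIso_mem
    [(ofFunctor Φ₂ F₂).isotropicObjects.IsClosedUnderIsomorphisms]
    (hinv : (ofFunctor Φ₂ F₂).isotropicObjects.inverseImage Ψ.functor = (ofFunctor Φ₁ F₁).isotropicObjects)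
    (hunits : ∀ (A : C₁) (δ : Aut A), δ ∈ PreFrobenioid.unitsSubgroup F₁ A →
      Ψ.functor.mapIso δ ∈ PreFrobenioid.unitsSubgroup F₂ (Ψ.functor.obj A)) :
    PreservesUnitEquiv (ofFunctor Φ₁ F₁) (ofFunctor Φ₂ F₂) (Ψ.congrFullSubcategory hinv).functor :=
  unitEquiv_map_of_units _ _ (Ψ.congrFullSubcategory hinv).functor fun X δ hδ =>
    ⟨Ψ.functor.mapIso δ, hunits X.obj δ hδ, rfl⟩

/-- **`Ψ^istr` preserves `≈^{O^×}` over Div-slim bases** (Cor. 4.11 (i), pp. 92–93: "it suffices to show that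
`Ψ` preserves '`O^×(-)`'", which holds when `C₂` is a Frobenioid with Div-slim base, `Ψ⁻¹` preserves pull-back
morphisms and `Ψ` preserves Div-identity endomorphisms — `mapIso_mem_unitsSubgroup_of_isDivSlim`).
[cite: MochizukiFrdI2008, Cor. 4.11 (i) p.92] -/
theorem preservesUnitEquiv_istr_of_isDivSlim (hF₂ : PreFrobenioid.IsFrobenioid F₂)
    (hiso : ∀ A : C₁, (ofFunctor Φ₂ F₂).IsIsotropic (Ψ.functor.obj A) ↔ (ofFunctor Φ₁ F₁).IsIsotropic A)
    (hds₂ : (ofFunctor Φ₂ F₂).IsDivSlim)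
    (hpb' : PreservesMor Ψ.inverse (ofFunctor Φ₂ F₂).IsPullbackMorphism (ofFunctor Φ₁ F₁).IsPullbackMorphism)
    (hdi : ∀ (A : C₁) (φ : A ⟶ A), (ofFunctor Φ₁ F₁).IsDivIdentity φ →
      (ofFunctor Φ₂ F₂).IsDivIdentity (Ψ.functor.map φ)) :
    ∃ (_ : (ofFunctor Φ₂ F₂).isotropicObjects.IsClosedUnderIsomorphisms)
      (hinv : (ofFunctor Φ₂ F₂).isotropicObjects.inverseImage Ψ.functor = (ofFunctor Φ₁ F₁).isotropicObjects),
      PreservesUnitEquiv (ofFunctor Φ₁ F₁) (ofFunctor Φ₂ F₂) (Ψ.congrFullSubcategory hinv).functor := by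
  haveI : (ofFunctor Φ₂ F₂).isotropicObjects.IsClosedUnderIsomorphisms :=
    ⟨fun e hX => (ofFunctor_isIsotropic F₂ _).2
      (PreFrobenioid.IsIsotropic.of_iso hF₂.isPreFrobenioid e.symm ((ofFunctor_isIsotropic F₂ _).1 hX))⟩
  have hinv : (ofFunctor Φ₂ F₂).isotropicObjects.inverseImage Ψ.functor = (ofFunctor Φ₁ F₁).isotropicObjects := by
    funext X
    exact propext (hiso X)
  exact ⟨inferInstance, hinv, preservesUnitEquiv_istr_of_mapIso_mem F₁ F₂ Ψ hinv fun A δ hδ =>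
    PreFrobenioid.mapIso_mem_unitsSubgroup_of_isDivSlim F₁ F₂ Ψ hF₂ hds₂ hpb' hdi δ hδ⟩

end Functor

end PreFrobenioidData

end Literature.AlgebraicGeometry.Frobenioids
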